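import Summits.QuantumFields.BalabanUV.T4Continuum.Support.NE7CurvedSupLetter
import HarnessLib

/-!
# NE7SliceStepContractionCurved — THE SPLIT OF THE ONE-STEP ERROR FIELD WITH ITS SIZES, NOW UNCONDITIONAL: gen 100's `NE7SliceStepContraction.split_error_sized` with its displayed hypothesis
# `hLet` (THE CURVED SUP LETTER (L)) DISCHARGED by gen 101's `NE7CurvedSupLetter.curved_sup_letter` — the only price is the smallness `(L^{k+1})²·x ≤ ε₁` of the plaquette radius (a function of
# `d`, `L`, `card n`), which the END's regime lines already carry

Cell `pub-balaban`, rung (B)+1 sub-cell t4, lineage `b2b-balaban-t4-ne7-p1`, generation 101 (CRUX PROVER NE7 #1 = OWNER of BINDER row NE7).  Memo `t4/b2b-balaban-t4-ne7-p1-g101/ROAD-G101.md` §7.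
WHAT ([folklore]; 0 def, 0 sorry; dimension `d + 1 ≥ 2`, `L ≥ 2`).  **`split_error_sized_curved`**: `∃ K > 0, ∃ ε₁ > 0` (from `curved_sup_letter`; `ε₁ := min ε₀ (1∕(32K(d+1)+1))` also makes the
absorption `16K(d+1)·M²x ≤ 1∕2` of F3b automatic) such that for every `k`, `N`, every unitary `W` of period `tower L N (k+1)` in the class with Poincaré parameter `θ_P ≤ 1∕2` and `(L^{k+1})²x ≤ ε₁`,
every error field `E` (skew periodic, `dirIter E = gaugeDir_V j`, `‖E‖ ≤ e_E`, `‖curl_W E‖ ≤ c_E`, `‖j‖ ≤ e_c`) splits as in F3b with THE SAME displayed sizes.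
HONEST FRAMING (page 1): a junction of two landed theorems; nothing of Bałaban's asserted; NOT yet F3c∕F4, NOT (S1), NOT NE7; spine 0∕9; finite T⁴ rung (B)+1 — NOT infinite volume, NOT mass gap, NOT
BetaPertH, NOT Clay.  Continuum YM on T⁴ ⇐ BetaPertH ∧ nine spine estimates (0/9 proved); BetaPertH ⇐ (D1) ∧ (D4) ∧ CAP+tail; G-an2-4 gates asym, D1 and NE2/3/4.
-/

set_option autoImplicit false

open scoped BigOperators Matrix.Norms.L2Operator
open Finset

namespace Summit.QuantumFields.BalabanUV.T4Continuum.NE7SliceStepContractionCurved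

open Literature.MathematicalPhysics.QuantumFieldTheory.Balaban1983to89
open B7Prop1Explicit B7Prop2Explicit
open T4AveragingDeficitWall (IsUnitaryCfg IsSkewDir SmallField Ad curlAt)
open T4AveragingDeficitWallBoundary (IsPeriodicCfg periodBox)
open AveragingDeficitPeriodicCounting (IsPeriodicDir)
open AveragingDeficitTwoLevelPrep (prop1Radius)
open AveragingDeficitMultiLevelPrep (cavgIter LevelSmall tower)
open BlockAveragePushDirGauge (gaugeDir)
open NE3TangentCovariantTower (dirIter framePotW)
open NE3CovariantBlockMean (bmeanIterW)
open NE3RightInverseSupLetters (frameC)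
open NE7MeanZeroGaugeSliceW (energyBlockLandauW)
open SpreadLift (loopRad)
open NE7SliceStepContraction (split_error_sized)
open NE7CurvedSupLetter (curved_sup_letter)

noncomputable section

variable {d : ℕ} {n : Type*} [Fintype n] [DecidableEq n]

/-- **F3b UNCONDITIONAL** (dimension `d + 1 ≥ 2`, `L ≥ 2`): the split of the one-step error field with its sizes (`NE7SliceStepContraction.split_error_sized`), the curved sup letter supplied by
`NE7CurvedSupLetter.curved_sup_letter`. [folklore] -/
theorem split_error_sized_curved [Nonempty n] (hd : 1 ≤ d) {L : ℕ} (hL : 2 ≤ L) :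
    ∃ K : ℝ, 0 < K ∧ ∃ ε₁ : ℝ, 0 < ε₁ ∧ ∀ (k N : ℕ) [NeZero N] (W : Site (d + 1) → Fin (d + 1) → (Matrix n n ℂ)ˣ) (x : ℝ),
      IsUnitaryCfg W → IsPeriodicCfg W ((tower L N (k + 1) : ℕ) : ℤ) → 0 ≤ x → LevelSmall (d + 1) L k x → SmallField W x →
      4 * (((d + 1 : ℕ) : ℝ)) ^ 2 * ((L : ℝ) ^ (k + 1) - 1) ^ 2 * x + 16 * ((d + 1 : ℕ) : ℝ) * loopRad (d + 1) L ((prop1Radius (d + 1) L)^[k] x)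
        + 4 * ((d + 1 : ℕ) : ℝ) * ((((d + 1 : ℕ) : ℝ)) - 1) * ((L : ℝ) ^ (k + 1) - 1) ^ 2 * x ≤ 1 / 2 →
      ((L : ℝ) ^ (k + 1)) ^ 2 * x ≤ ε₁ →
      ∀ {E : Site (d + 1) → Fin (d + 1) → Matrix n n ℂ}, IsSkewDir E → IsPeriodicDir E ((tower L N (k + 1) : ℕ) : ℤ) →
      ∀ {j : Site (d + 1) → Matrix n n ℂ}, (∀ z, j z ∈ skewAdjoint (Matrix n n ℂ)) → (∀ (z : Site (d + 1)) (i : Fin (d + 1)), j (z + (N : ℤ) • e i) = j z) →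
      dirIter L (k + 1) W E = gaugeDir (cavgIter L (k + 1) W) j →
      ∀ {eE cE ec : ℝ}, 0 ≤ eE → 0 ≤ cE → (∀ y κ, ‖E y κ‖ ≤ eE) → (∀ (z : Site (d + 1)) (μ ν : Fin (d + 1)), μ ≠ ν → ‖curlAt W E z μ ν‖ ≤ cE) → (∀ z, ‖j z‖ ≤ ec) →
    ∃ (ζ : Site (d + 1) → Matrix n n ℂ) (YE : Site (d + 1) → Fin (d + 1) → Matrix n n ℂ),
      (∀ y, ζ y ∈ skewAdjoint (Matrix n n ℂ)) ∧ (∀ (y : Site (d + 1)) (i : Fin (d + 1)), ζ (y + ((tower L N (k + 1) : ℕ) : ℤ) • e i) = ζ y) ∧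
      YE ∈ energyBlockLandauW (d := d + 1) (n := n) L N (k + 1) W ∧
      (∀ y μ, E y μ = YE y μ + gaugeDir W ζ y μ) ∧
      (∀ z, bmeanIterW L (k + 1) W ζ z = -(framePotW L (k + 1) W E z - j z)) ∧
      (∀ z, ‖framePotW L (k + 1) W E z - j z‖ ≤ frameC (d + 1) L * (L : ℝ) ^ (k + 1) * eE + ec) ∧
      (∀ y μ, ‖YE y μ‖ ≤ 2 * K * (L : ℝ) ^ (k + 1) * cE + 8 * K * (((L : ℝ) ^ (k + 1)) ^ 2 * x) * (frameC (d + 1) L * (L : ℝ) ^ (k + 1) * eE + ec) / (L : ℝ) ^ (k + 1)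
          + 16 * K * ((d + 1 : ℕ) : ℝ) * (((L : ℝ) ^ (k + 1)) ^ 2 * x) * eE) ∧
      (∀ y μ, ‖gaugeDir W ζ y μ‖ ≤ eE + (2 * K * (L : ℝ) ^ (k + 1) * cE + 8 * K * (((L : ℝ) ^ (k + 1)) ^ 2 * x) * (frameC (d + 1) L * (L : ℝ) ^ (k + 1) * eE + ec) / (L : ℝ) ^ (k + 1)
          + 16 * K * ((d + 1 : ℕ) : ℝ) * (((L : ℝ) ^ (k + 1)) ^ 2 * x) * eE)) ∧
      (∀ y, ‖ζ y‖ ≤ 2 * ((frameC (d + 1) L * (L : ℝ) ^ (k + 1) * eE + ec) + 2 * ((d + 1 : ℕ) : ℝ) * (L : ℝ) ^ (k + 1) *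
          (eE + (2 * K * (L : ℝ) ^ (k + 1) * cE + 8 * K * (((L : ℝ) ^ (k + 1)) ^ 2 * x) * (frameC (d + 1) L * (L : ℝ) ^ (k + 1) * eE + ec) / (L : ℝ) ^ (k + 1)
            + 16 * K * ((d + 1 : ℕ) : ℝ) * (((L : ℝ) ^ (k + 1)) ^ 2 * x) * eE)))) := by
  obtain ⟨K, hK, ε₀, hε₀, hcurved⟩ := curved_sup_letter (n := n) hd hL
  refine ⟨K, hK, min ε₀ (1 / (32 * K * ((d + 1 : ℕ) : ℝ) + 1)), lt_min hε₀ (by positivity), ?_⟩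
  intro k N _ W x hWu hWP hx hs hWx hθP hε E hEs hEP j hjs hjP hdir eE cE ec heE0 hcE0 hE hcE hj
  have hε0' : ((L : ℝ) ^ (k + 1)) ^ 2 * x ≤ ε₀ := hε.trans (min_le_left _ _)
  have hKε : 16 * K * ((d + 1 : ℕ) : ℝ) * (((L : ℝ) ^ (k + 1)) ^ 2 * x) ≤ 1 / 2 := by
    have h1 : ((L : ℝ) ^ (k + 1)) ^ 2 * x ≤ 1 / (32 * K * ((d + 1 : ℕ) : ℝ) + 1) := hε.trans (min_le_right _ _)
    have hpos : 0 < 32 * K * ((d + 1 : ℕ) : ℝ) + 1 := by positivity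
    have h2 : 16 * K * ((d + 1 : ℕ) : ℝ) * (1 / (32 * K * ((d + 1 : ℕ) : ℝ) + 1)) ≤ 1 / 2 := by
      rw [mul_one_div, div_le_iff₀ hpos]; nlinarith [hK.le, (Nat.cast_nonneg (d + 1) : (0:ℝ) ≤ ((d + 1 : ℕ) : ℝ))]
    exact (mul_le_mul_of_nonneg_left h1 (by positivity)).trans h2
  have hLet : ∀ Y : Site (d + 1) → Fin (d + 1) → Matrix n n ℂ, Y ∈ energyBlockLandauW (d := d + 1) (n := n) L N (k + 1) W →
      ∀ B : ℝ, (∀ (z : Site (d + 1)) (μ ν : Fin (d + 1)), μ ≠ ν → ‖curlAt W Y z μ ν‖ ≤ B) → ∀ (y : Site (d + 1)) (κ : Fin (d + 1)), ‖Y y κ‖ ≤ K * (L : ℝ) ^ (k + 1) * B :=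
    fun Y hY B hB y κ => hcurved k N W x hWu hWP hx hs hWx hε0' Y hY B hB y κ
  exact split_error_sized (d := d + 1) (Nat.succ_pos d) hL k hWu hWP hx hs hWx hθP hK.le hKε hLet hEs hEP hjs hjP hdir heE0 hcE0 hE hcE hj

end

end Summit.QuantumFields.BalabanUV.T4Continuum.NE7SliceStepContractionCurved
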